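import Summits.QuantumFields.YangMills.Theorems.UnitScaleTiltProp7BlockBumpExtension
import Summits.QuantumFields.YangMills.Theorems.UnitScaleTiltProp7BlockFatBump
import HarnessLib

/-!
# Route `UnitScaleTilt`, crux K1 child «MinimiserStabilityRegPr» (stmt-QuantumFields-19200), skeleton v10, stub `stub_existenceMinimalOrbit` (EX), route (α) —
# **(ROW-R2q″, FILE 2c) THE INSTANTIATED EXTENSION: FAT BUMP × CORNER-AXIAL FRAMED CONSTANT, WITH THE (d2) IDENTITIES** — ✓`Prop7BlockBumpExtension.exists_blockBumpExtension_rows`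
# (v1.1) at the bump of ✓`Prop7BlockFatBump.exists_fatBump` (`lχ = 1∕(w·L^k) = η∕w`), together with the two identities the (P2)-knit's `happrox` needs BY NAME: the framed constant
# read back in the reference frame is the bump times the constant, `conjR (C k Y x) (S c x) = χ_Y(x)·c(Y)`, and hence the REFERENCE MEAN of ✓`Prop7NestedMeanPoincare.norm_ns_sub_refMean_le`
# at `l := S c` is `κ·c(Y)` EXACTLY (mass identity).

Cell `ym3-torus`, width seat `ym3-torus-px10` (gen 2).  THEOREMS ONLY (0 `def`, 0 `sorry`).  `--supports stmt-QuantumFields-19200 --as helper`, count-neutral.  YM₃ on T³ is a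
ladder rung (R3), not the Clay problem; nothing here claims the stub, the crux, d = 4 or the mass gap.

WHAT IS PROVED (sorry-free, no definition; ns `…Theorems.Prop7BlockBumpExtension`): `conjR_mul_conjR_inv_smul` (the read-back identity, generic), ★★★`exists_fatBlockBumpExtension`
(member `F`, `n ≤ K`, `k = K − n`): `∃ S χ κ` with the defining formula, `hS0`∕`hS1` in the (P2)-knit's currency (`s₀ = √2`, `s₁ = √6·(2s₀^{ax} + η∕w)∕η`), the bump rows, the read-back
identity, the reference-mean identity, the block mass `Σ_{x∈B^k Y}‖S c x‖ = κ·L^{dk}·‖c Y‖`, and `(1 − 2w − 2η)³ ≤ κ ≤ 1`.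
HONEST SCOPE: assembly of ✓FILE 2 v1.1 + ✓FILE 2b; the bond row `hax` (★px11 g2) stays displayed; nothing of print asserted.

References: T. Bałaban, CMP 99 (1985) 389–434 [Balaban1985BackgroundPropagators] ((3.19) p.393, (3.114)–(3.115) p.418); CMP 99 (1985) 75–102 [Balaban1985RegularSpaces] (Lemma 1 (1.25) p.79);
CMP 95 (1984) 17–40 [Balaban1984PropagatorsI] ((1.6) p.18, (1.18) p.20).
-/

set_option autoImplicit false

noncomputable section

open scoped BigOperators Matrix.Norms.L2Operator

namespace Summit.QuantumFields.YangMills.Theorems.Prop7BlockBumpExtension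

open Literature.MathematicalPhysics.QuantumFieldTheory.Balaban1983to89
open Literature.MathematicalPhysics.QuantumFieldTheory.Balaban1983to89.T3ContinuumYM3Torus
open T4Continuum BlockAveraging
open B5Eq118OneStroke (iterBlockOf iterBlock mem_iterBlock)
open B15DeterminingSets (embIter)
open T3LevelShift (siteShift)
open T3PrintedRegularOrbits (sites_eq)
open T3SectALandauChart (eta eta_pos bgUnits)
open B7Prop1Explicit (U1 mem_U1)
open B7Eq78Linearization (conjR conjR_apply conjR_smul_real)
open B8Ineq132 (norm_conjR)
open B8Ineq132 (conjR_conjR one_conjR)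
open B10Eq27TorusAxialLog (unitsField toUField)
open B10Eq27TorusAxialLog (axialT gaugeActT)
open Summit.QuantumFields.YangMills.Theorems.Prop7SectET3HilbertLetters (toL2S DL2)
open Summit.QuantumFields.YangMills.Theorems.Prop7BlockFatBump (exists_fatBump)

/-- **READ-BACK**: `conjR C (t • conjR C⁻¹ X) = t • X`. [folklore] -/
theorem conjR_mul_conjR_inv_smul {𝔸 : Type*} [NormedRing 𝔸] [NormedAlgebra ℂ 𝔸] (C : 𝔸ˣ) (t : ℝ) (X : 𝔸) : conjR C (t • conjR C⁻¹ X) = t • X := by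
  rw [conjR_smul_real, conjR_conjR, mul_inv_cancel, one_conjR]

variable (F : T3Family) {n K : ℕ} (h : n ≤ K)

/-- ★★★ **THE INSTANTIATED BLOCK BUMP EXTENSION** (FILE 2 v1.1 at FILE 2b's fat separable bump, `lχ = η∕w`): for a collar `0 < w` with `2w + 2η ≤ 1`, a base-point map `q` and the bond row
`hax` (★px11 g2), there are a ℂ-linear `S`, a bump family `χ` and a mass `κ` with: the defining formula; `‖toL2S F K c₀ (S c)‖ ≤ √2·q c` and
`‖D_{U₀}(toL2S F K c₀ (S c))‖ ≤ (√6(2s₀ + η∕w)∕η)·q c` in the (P2)-knit's currency `q c = ‖toL2S F n c₁ (c ∘ siteShift)‖`, `c₁ = c₀η⁻³`; the bump rows; the READ-BACK identity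
`conjR (C k (Y x) x) (S c x) = χ_{Y x}(x)·c(Y x)`; the REFERENCE-MEAN identity `((L^d)^k)⁻¹·Σ_{x∈B^k(Y)} conjR (C k Y x) (S c x) = κ·c(Y)` in ★px11's letters
`C k Y x = (axialT U (q (B^k x)) (embIter k Y))⁻¹·axialT U (q (B^k x)) x`; and `(1 − 2w − 2η)³ ≤ κ ≤ 1`. [cite: Balaban1985BackgroundPropagators, (3.19) p.393, (3.114)-(3.115) p.418; Balaban1985RegularSpaces, Lemma 1 (1.25) p.79; Balaban1984PropagatorsI, (1.18) p.20] -/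
theorem exists_fatBlockBumpExtension {c₀ c₁ : ℝ} [Fact (0 < c₀)] [Fact (0 < c₁)] (hc₁ : c₁ = c₀ * (eta F n K)⁻¹ ^ 3)
    (U₀ : GaugeField (F.P K) 0 (Matrix.specialUnitaryGroup (Fin 2) ℂ)) (q : Site (F.P K) (K - n) → Site (F.P K) 0)
    {w s₀ : ℝ} (hw : 0 < w) (hwin : 2 * w + 2 * eta F n K ≤ 1) (hs₀ : 0 ≤ s₀)
    (hax : ∀ (Y : Site (F.P K) (K - n)) (b : PBond (F.P K) 0), iterBlockOf (K - n) b.src = Y → iterBlockOf (K - n) b.tgt = Y →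
      ‖((gaugeActT (axialT (bgUnits F K U₀) (q Y)) (bgUnits F K U₀) b : (Matrix (Fin 2) (Fin 2) ℂ)ˣ) : Matrix (Fin 2) (Fin 2) ℂ) - 1‖ ≤ s₀) :
    ∃ (S : (Site (F.P K) (K - n) → Matrix (Fin 2) (Fin 2) ℂ) →ₗ[ℂ] (Site (F.P K) 0 → Matrix (Fin 2) (Fin 2) ℂ))
      (χ : Site (F.P K) (K - n) → Site (F.P K) 0 → ℝ) (κ : ℝ),
      (∀ c x, S c x = (χ (iterBlockOf (K - n) x) x) •
        conjR ((axialT (bgUnits F K U₀) (q (iterBlockOf (K - n) x)) (embIter (K - n) (iterBlockOf (K - n) x)))⁻¹ *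
          axialT (bgUnits F K U₀) (q (iterBlockOf (K - n) x)) x)⁻¹ (c (iterBlockOf (K - n) x))) ∧
      (∀ c, ‖toL2S F K c₀ (S c)‖ ≤ Real.sqrt 2 * ‖toL2S F n c₁ (fun y => c (siteShift (sites_eq F n K h) y))‖) ∧
      (∀ c, ‖DL2 F n K c₀ U₀ (toL2S F K c₀ (S c))‖ ≤
        (Real.sqrt 6 * ((2 * s₀ + eta F n K / w) / eta F n K)) * ‖toL2S F n c₁ (fun y => c (siteShift (sites_eq F n K h) y))‖) ∧
      (∀ Y x, 0 ≤ χ Y x ∧ χ Y x ≤ 1) ∧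
      (∀ Y x μ, χ Y x ≠ 0 → iterBlockOf (K - n) (x.shift μ) = Y) ∧ (∀ Y x μ, χ Y x ≠ 0 → iterBlockOf (K - n) (x.unshift μ) = Y) ∧
      (∀ Y x μ, |χ Y (x.shift μ) - χ Y x| ≤ eta F n K / w) ∧
      (∀ c x, conjR ((axialT (bgUnits F K U₀) (q (iterBlockOf (K - n) x)) (embIter (K - n) (iterBlockOf (K - n) x)))⁻¹ *
          axialT (bgUnits F K U₀) (q (iterBlockOf (K - n) x)) x) (S c x) = (χ (iterBlockOf (K - n) x) x) • c (iterBlockOf (K - n) x)) ∧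
      (∀ c Y, ((((F.P K).L : ℝ) ^ (F.P K).d) ^ (K - n))⁻¹ •
          ∑ x ∈ iterBlock (K - n) Y, conjR ((axialT (bgUnits F K U₀) (q (iterBlockOf (K - n) x)) (embIter (K - n) Y))⁻¹ *
            axialT (bgUnits F K U₀) (q (iterBlockOf (K - n) x)) x) (S c x) = κ • c Y) ∧
      (∀ c Y, ∑ x ∈ iterBlock (K - n) Y, ‖S c x‖ = κ * ((((F.P K).L : ℝ) ^ (F.P K).d) ^ (K - n)) * ‖c Y‖) ∧
      (1 - 2 * w - 2 * eta F n K) ^ 3 ≤ κ ∧ κ ≤ 1 := by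
  have hk : K - n ≤ (F.P K).m + (F.P K).K := by show K - n ≤ F.m + K; omega
  have hd : (F.P K).d = 3 := T3Family.P_d F K
  have hLL : ((F.P K).L : ℝ) = (F.L : ℝ) := rfl
  have hη : 0 < eta F n K := eta_pos F n K
  have hηL : eta F n K = ((F.L : ℝ) ^ (K - n))⁻¹ := by
    show ((F.L : ℝ)⁻¹) ^ (K - n) = _; rw [inv_pow]
  have hL0 : (0 : ℝ) < (F.L : ℝ) ^ (K - n) := by rw [← inv_pos, ← hηL]; exact hη
  have h2η : 2 / ((F.P K).L : ℝ) ^ (K - n) = 2 * eta F n K := by rw [hLL, hηL, div_eq_mul_inv]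
  have hlχ : 1 / (w * ((F.P K).L : ℝ) ^ (K - n)) = eta F n K / w := by rw [hLL, hηL]; field_simp
  -- the bump
  have hwin' : 2 * w + 2 / ((F.P K).L : ℝ) ^ (K - n) ≤ 1 := by rw [h2η]; exact hwin
  obtain ⟨χ, κ, hχ01, hχsh, hχun, hχlip, hmass, hκlo, hκhi⟩ := exists_fatBump (P := F.P K) hk hw hwin'
  have hχlip' : ∀ Y x μ, |χ Y (x.shift μ) - χ Y x| ≤ eta F n K / w := fun Y x μ => (hχlip Y x μ).trans (le_of_eq hlχ)
  have hκlo' : (1 - 2 * w - 2 * eta F n K) ^ 3 ≤ κ := by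
    have h3 := hκlo
    rw [h2η, hd] at h3
    exact h3
  -- the extension
  obtain ⟨S, hS, h0, h1⟩ := exists_blockBumpExtension_rows F h hc₁ U₀ q χ hs₀ (by positivity : 0 ≤ eta F n K / w) hχ01 hχsh hχun hχlip' hax
  -- the read-back identity
  have hread : ∀ c x, conjR ((axialT (bgUnits F K U₀) (q (iterBlockOf (K - n) x)) (embIter (K - n) (iterBlockOf (K - n) x)))⁻¹ *
      axialT (bgUnits F K U₀) (q (iterBlockOf (K - n) x)) x) (S c x) = (χ (iterBlockOf (K - n) x) x) • c (iterBlockOf (K - n) x) := by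
    intro c x; rw [hS]; exact conjR_mul_conjR_inv_smul _ _ _
  -- the frames are `U1`-valued, so `‖S c x‖ = χ·‖c‖`
  have hU : ∀ b, bgUnits F K U₀ b ∈ U1 (Matrix (Fin 2) (Fin 2) ℂ) := by
    intro b
    have hval : ((bgUnits F K U₀ b : (Matrix (Fin 2) (Fin 2) ℂ)ˣ) : Matrix (Fin 2) (Fin 2) ℂ) = ((U₀ b : Matrix.specialUnitaryGroup (Fin 2) ℂ) : Matrix (Fin 2) (Fin 2) ℂ) := rfl
    have hinv : (((bgUnits F K U₀ b)⁻¹ : (Matrix (Fin 2) (Fin 2) ℂ)ˣ) : Matrix (Fin 2) (Fin 2) ℂ) = star (((U₀ b : Matrix.specialUnitaryGroup (Fin 2) ℂ) : Matrix (Fin 2) (Fin 2) ℂ)) := by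
      rw [← hval]; exact Prop7CovariantCoercivity.coe_inv_eq_star (toUField U₀ b).2
    have h1 : ‖((U₀ b : Matrix.specialUnitaryGroup (Fin 2) ℂ) : Matrix (Fin 2) (Fin 2) ℂ)‖ = 1 := CStarRing.norm_of_mem_unitary (toUField U₀ b).2
    rw [mem_U1, hval, hinv, norm_star]
    exact ⟨h1.le, h1.le⟩
  have hfrU : ∀ (Y : Site (F.P K) (K - n)) (x : Site (F.P K) 0),
      ((axialT (bgUnits F K U₀) (q Y) (embIter (K - n) Y))⁻¹ * axialT (bgUnits F K U₀) (q Y) x)⁻¹ ∈ U1 (Matrix (Fin 2) (Fin 2) ℂ) := by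
    intro Y x
    have hw' : ∀ z, axialT (bgUnits F K U₀) (q Y) z ∈ U1 (Matrix (Fin 2) (Fin 2) ℂ) := fun z => Prop7SymAvgTwSym.holT_mem_U1 hU _ _
    exact (U1 _).inv_mem ((U1 _).mul_mem ((U1 _).inv_mem (hw' _)) (hw' _))
  have hnorm : ∀ c x, ‖S c x‖ = χ (iterBlockOf (K - n) x) x * ‖c (iterBlockOf (K - n) x)‖ := by
    intro c x
    rw [hS, norm_smul, norm_conjR (hfrU _ _), Real.norm_eq_abs, abs_of_nonneg (hχ01 _ _).1]
  have hpow : (((F.P K).L : ℝ) ^ (K - n)) ^ (F.P K).d = (((F.P K).L : ℝ) ^ (F.P K).d) ^ (K - n) := by rw [← pow_mul, ← pow_mul, mul_comm]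
  refine ⟨S, χ, κ, hS, h0, h1, hχ01, hχsh, hχun, hχlip', hread, fun c Y => ?_, fun c Y => ?_, hκlo', hκhi⟩
  rotate_left
  · -- the block mass of `S c`
    rw [Finset.sum_congr rfl fun x hx => by rw [hnorm, (mem_iterBlock _ _ _).1 hx], ← Finset.sum_mul, hmass, hpow]
  -- the reference-mean identity on `B^k(Y)`
  have hsum : ∑ x ∈ iterBlock (K - n) Y, conjR ((axialT (bgUnits F K U₀) (q (iterBlockOf (K - n) x)) (embIter (K - n) Y))⁻¹ *
        axialT (bgUnits F K U₀) (q (iterBlockOf (K - n) x)) x) (S c x) = (∑ x ∈ iterBlock (K - n) Y, χ Y x) • c Y := by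
    rw [Finset.sum_smul]
    refine Finset.sum_congr rfl fun x hx => ?_
    have hY : iterBlockOf (K - n) x = Y := (mem_iterBlock _ _ _).1 hx
    have h := hread c x
    rw [hY] at h ⊢
    exact h
  have hM : ((((F.P K).L : ℝ) ^ (F.P K).d) ^ (K - n)) ≠ 0 := by
    rw [hLL]; exact pow_ne_zero _ (pow_ne_zero _ (by exact_mod_cast (ne_of_gt (by have := F.hL.2; omega : 0 < F.L))))
  rw [hsum, hmass, smul_smul, hpow, mul_comm κ, inv_mul_cancel_left₀ hM]

end Summit.QuantumFields.YangMills.Theorems.Prop7BlockBumpExtension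

end
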